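import Mathlib
import Literature.Barriers.PneNP.TSPExtensionComplexityFaces
import Literature.Barriers.PneNP.ExtendedFormulationLinearImage
import Literature.Barriers.PneNP.CorrelationPolytopeXCLowerBoundGraph
import Summits.ValiantsHypothesis.ValiantsHypothesis.Theorems.FifoMatchingNNDivisionHardRowFamilies
import HarnessLib

/-!
# THE EXACT LOCATED LAW *IS* COR-VIRTUAL — `ExactPencilLaw ↔ CorVirtualHardN` (crux `NNDivisionHard`,
stmt-ValiantsHypothesis-21181; route `FifoMatching`; line `virtual_passenger`; val-idea-41 g4, WAVE 7, REFUTE lens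
«a Q with small xc(COR+Q)»)

The tree (`Theorems/FifoMatchingNNDivisionHardRowFamilies.lean`, `exact_law_chain`) has the chain of laws
"strongest first" `pinnedRows.Law → ExactPencilLaw → allRows.Law → CorVirtualHardN`.  This file CLOSES THE CYCLE:

* `law_of_corVirtualHardN` — for every SHARP row family `F` (def `Sharp`: for every direction `w` and every
  `δ > 0` the family contains a positive multiple `t • w` of `w` whose right-hand side is `δ`-close to exact,
  `β ≤ t (h_COR(w) + δ)`), `CorVirtualHardN → F.Law`;
* `exactTilted_sharp`, `pinnedRows_sharp`, `allRows_sharp` — the three families of record are sharp (the pure-tilt rows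
  `a = ∅`: `udRow ∅ = 0`, and the clique offset `+1` in `β` is scaled away along the pencil `(∅, w/δ)`);
* hence `exactPencilLaw_iff_corVirtualHardN : ExactPencilLaw ↔ CorVirtualHardN`, `pinnedRowsLaw_iff_corVirtualHardN`,
  `allRowsLaw_iff_corVirtualHardN`, `located_laws_equivalent` — ALL FOUR LAWS ARE ONE STATEMENT.

MECHANISM (Yannakakis' converse for a COMPLETE, possibly infinite, inequality family — §2
`hasEFOfSize_of_complete_nonneg_factorization`, self-contained over `HasEFOfSize` [Yannakakis 1991 Thm 3; FMPTdW 2015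
Thm 3], specialised in `hasEFOfSize_of_sharp_factorization`): an `F`-blind nonnegative
factorisation `β_a + m_a − ρ_a·(x_b + q_j) = Σ_{i ∈ σ} U_a(i) V_{bj}(i)` (`U, V ≥ 0`) of the `F`-slack of `COR(n) + Q`
gives the slack-form system `{x | ∃ y ≥ 0, ∀ a, ρ_a·x + U_a·y = β_a + m_a}` with `|σ|` slack variables (finitely many of
the equations suffice: a finite spanning set of the triples `(ρ_a, U_a, β_a + m_a)`), and its projection is EXACTLY
`COR(n) + Q`: `⊇` lift `x_b + q_j` with `y = V_{bj}`; `⊆` `y ≥ 0` gives `ρ_a·x ≤ β_a + m_a` for every row, sharpness and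
`m_a = ρ_a·q_{j*}` give `w·x ≤ h_COR(w) + h_Q(w) + δ` for every `w, δ`, and a point outside the compact convex set
`COR(n) + Q` would be strictly separated (Hahn–Banach).  So `xc(COR(n) + Q) ≤ |σ| = r + 1`; with `HasEFOfSize.succ` on
`Q`, `CorVirtualHardN` at `c + 1` and `T c n < T (c+1) n` (`n ≥ 2`) the law's conclusion `T c n < r` follows.

CONSEQUENCES (memo `ExactIsVirtual41.md`): an "enemy of C′ = `ExactPencilLaw`" is literally a counterexample to
COR-VIRTUAL; a row family is a PROPER intermediate law only if it is not sharp (no pure-tilt rows, bounded tilt-to-clique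
ratio); «C′ holds on species X» ≡ «COR-VIRTUAL on X».

HONEST LABEL: closes NO route item; `ExactPencilLaw`, `CorVirtualHardN`, `NNDivisionHard` (21181) stay OPEN — this file
proves they are EQUIVALENT to each other (the first two) and nothing about their truth; VP ≠ VNP is NOT proved.
-/

set_option autoImplicit false
set_option linter.dupNamespace false
set_option linter.unusedVariables false

noncomputable section

open Matrix Finset
open scoped Pointwise

namespace Summit.ValiantsHypothesis.ValiantsHypothesis.Cruxes.NNDivisionHard.ValIdea41.ExactIsVirtual

open Literature.Barriers.PneNP (HasEFOfSize hasEFOfSize_of_system)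
open Literature.Combinatorics.Optimization.FixedSizePsdRank (Cube bvec flat vecOuter corPolytope)
open Literature.Combinatorics.Optimization (corPolytopeGraph)
open Summit.ValiantsHypothesis.ValiantsHypothesis.Theorems.FifoMatching.XcDivision (udInd udPt udRow udMat ud_data)
open Summit.ValiantsHypothesis.ValiantsHypothesis.Theorems.FifoMatching.LocatedRows
  (T CorVirtualHardN RowFamily allRows exactTilted pinnedRows ExactPencilLaw hCOR le_hCOR exists_eq_hCOR flat_le_hCOR
    unflat flat_unflat exact_law_chain corVirtualHardN_of_law corVirtualHardN_of_exactPencilLaw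
    corVirtualHardN_of_pinnedRowsLaw)

/-! ## §1 Exact support values in vector currency -/

section Support
variable {n : ℕ}

/-- the exact support value `h_COR(w) = max_b ⟨w, 𝟙_b𝟙_bᵀ⟩` of a (flattened) direction `w ∈ ℝ^{n²}`. -/
def hCORv (w : Fin (n * n) → ℝ) : ℝ :=
  Finset.univ.sup' Finset.univ_nonempty (fun b : Finset (Fin n) => w ⬝ᵥ udPt b)

theorem le_hCORv (w : Fin (n * n) → ℝ) (b : Finset (Fin n)) : w ⬝ᵥ udPt b ≤ hCORv w :=
  Finset.le_sup' (fun b : Finset (Fin n) => w ⬝ᵥ udPt b) (Finset.mem_univ b)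

theorem exists_eq_hCORv (w : Fin (n * n) → ℝ) : ∃ b : Finset (Fin n), w ⬝ᵥ udPt b = hCORv w := by
  obtain ⟨b, -, hb⟩ := Finset.exists_mem_eq_sup' Finset.univ_nonempty (fun b : Finset (Fin n) => w ⬝ᵥ udPt b)
  exact ⟨b, hb.symm⟩

/-- `hCOR W = hCORv (flat W)` (definitional). -/
theorem hCOR_eq_hCORv (W : Matrix (Fin n) (Fin n) ℝ) : hCOR W = hCORv (flat W) := rfl

/-- `hCORv w = hCOR (unflat w)`. -/
theorem hCORv_eq_hCOR_unflat (w : Fin (n * n) → ℝ) : hCORv w = hCOR (unflat w) := by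
  rw [hCOR_eq_hCORv, flat_unflat]

/-- validity of the exact row `w ≤ h_COR(w)` on `COR(n)`. -/
theorem le_hCORv_of_mem (w : Fin (n * n) → ℝ) : ∀ x ∈ corPolytope n, w ⬝ᵥ x ≤ hCORv w := by
  intro x hx
  have h := flat_le_hCOR (unflat w) x hx
  rwa [flat_unflat, ← hCORv_eq_hCOR_unflat] at h

/-- positive homogeneity (the inequality we need): `h_COR(t w) ≤ t h_COR(w)` for `t ≥ 0`. -/
theorem hCORv_smul_le {t : ℝ} (ht : 0 ≤ t) (w : Fin (n * n) → ℝ) : hCORv (t • w) ≤ t * hCORv w := by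
  refine Finset.sup'_le _ _ fun b _ => ?_
  rw [smul_dotProduct, smul_eq_mul]
  exact mul_le_mul_of_nonneg_left (le_hCORv w b) ht

/-- the support value of the passenger's vertex list in direction `w`. -/
def hQv {K : ℕ} (q : Fin (K + 1) → (Fin (n * n) → ℝ)) (w : Fin (n * n) → ℝ) : ℝ :=
  Finset.univ.sup' Finset.univ_nonempty (fun j : Fin (K + 1) => w ⬝ᵥ q j)

theorem le_hQv {K : ℕ} (q : Fin (K + 1) → (Fin (n * n) → ℝ)) (w : Fin (n * n) → ℝ) (j : Fin (K + 1)) :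
    w ⬝ᵥ q j ≤ hQv q w :=
  Finset.le_sup' (fun j : Fin (K + 1) => w ⬝ᵥ q j) (Finset.mem_univ j)

theorem exists_eq_hQv {K : ℕ} (q : Fin (K + 1) → (Fin (n * n) → ℝ)) (w : Fin (n * n) → ℝ) :
    ∃ j : Fin (K + 1), w ⬝ᵥ q j = hQv q w := by
  obtain ⟨j, -, hj⟩ := Finset.exists_mem_eq_sup' Finset.univ_nonempty (fun j : Fin (K + 1) => w ⬝ᵥ q j)
  exact ⟨j, hj.symm⟩

/-- the clique vertex of a bit string: `vecOuter n (bvec a) = udPt {i | a i}`. -/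
theorem vecOuter_bvec_eq_udPt (a : Cube n) :
    vecOuter n (bvec a) = udPt (Finset.univ.filter fun i => a i = true) := by
  classical
  unfold udPt udInd
  congr 1
  funext i
  simp

/-- the pure-tilt row: `udRow ∅ = 0`. -/
theorem udRow_empty : udRow (∅ : Finset (Fin n)) = 0 := by
  funext p
  simp [udRow, udMat, udInd, flat, bvec]

/-- ★ SEPARATION: a point satisfying every exact inequality of `COR(n) + Q` lies in `COR(n) + Q` (Hahn–Banach for the
compact convex set `COR(n) + conv(q)`). -/
theorem mem_add_convexHull_of_forall_le {K : ℕ} (q : Fin (K + 1) → (Fin (n * n) → ℝ)) (x : Fin (n * n) → ℝ)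
    (h : ∀ w : Fin (n * n) → ℝ, w ⬝ᵥ x ≤ hCORv w + hQv q w) :
    x ∈ corPolytope n + convexHull ℝ (Set.range q) := by
  classical
  by_contra hx
  have hCc : IsCompact (corPolytope n) := by
    unfold corPolytope
    exact Set.Finite.isCompact_convexHull (𝕜 := ℝ) (Set.finite_range _)
  have hQc : IsCompact (convexHull ℝ (Set.range q)) :=
    Set.Finite.isCompact_convexHull (𝕜 := ℝ) (Set.finite_range _)
  have hPcl : IsClosed (corPolytope n + convexHull ℝ (Set.range q)) := (hCc.add hQc).isClosed
  have hPconv : Convex ℝ (corPolytope n + convexHull ℝ (Set.range q)) := by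
    refine Convex.add ?_ (convex_convexHull ℝ _)
    unfold corPolytope
    exact convex_convexHull ℝ _
  obtain ⟨f, u, hfP, hux⟩ := geometric_hahn_banach_closed_point hPconv hPcl hx
  -- the functional as a vector
  let w : Fin (n * n) → ℝ := fun p => f (Pi.single p 1)
  have hfw : ∀ z : Fin (n * n) → ℝ, f z = w ⬝ᵥ z := by
    intro z
    conv_lhs => rw [pi_eq_sum_univ' z]
    rw [map_sum]
    simp only [map_smul, smul_eq_mul, dotProduct, w]
    refine Finset.sum_congr rfl fun p _ => ?_
    ring
  obtain ⟨b, hb⟩ := exists_eq_hCORv w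
  obtain ⟨j, hj⟩ := exists_eq_hQv q w
  have hmem : udPt b + q j ∈ corPolytope n + convexHull ℝ (Set.range q) :=
    Set.add_mem_add ((ud_data n).1 b) (subset_convexHull ℝ _ ⟨j, rfl⟩)
  have h1 : f (udPt b + q j) < u := hfP _ hmem
  have h2 := h w
  rw [hfw, dotProduct_add, hb, hj] at h1
  rw [hfw] at hux
  linarith

end Support

/-! ## §2 Yannakakis' factorisation theorem — the CONVERSE half, for a COMPLETE (possibly infinite) inequality family

This section is self-contained over `Literature.Barriers.PneNP.HasEFOfSize` (suggested Literature home: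
`Literature/Barriers/PneNP/ExtendedFormulationYannakakisConverse.lean`, next to `HasEFOfSize.exists_nonneg_factorization`). -/

section Yannakakis
variable {ι : Type} [Fintype ι] {A B σ : Type} [Fintype σ]

/-- the data triple `(c_a, U_a, d_a)` of one row of a factorised slack system. [folklore bookkeeping] -/
abbrev Trip (ι σ : Type) : Type := (ι → ℝ) × ((σ → ℝ) × ℝ)

/-- the equation `θ.1·x + θ.2.1·y = θ.2.2` encoded by a triple holds on the span of any set of triples on which it holds.
[folklore linear algebra] -/
theorem eq_of_mem_span (x : ι → ℝ) (y : σ → ℝ) (s : Set (Trip ι σ))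
    (hs : ∀ θ ∈ s, θ.1 ⬝ᵥ x + θ.2.1 ⬝ᵥ y = θ.2.2) :
    ∀ θ ∈ Submodule.span ℝ s, θ.1 ⬝ᵥ x + θ.2.1 ⬝ᵥ y = θ.2.2 := by
  intro θ hθ
  induction hθ using Submodule.span_induction with
  | mem θ h => exact hs θ h
  | zero => simp
  | add θ₁ θ₂ _ _ h₁ h₂ =>
    simp only [Prod.fst_add, Prod.snd_add, add_dotProduct]
    linarith
  | smul c θ _ h =>
    simp only [Prod.smul_fst, Prod.smul_snd, smul_dotProduct, smul_eq_mul]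
    rw [← h]
    ring

/-- ★ **YANNAKAKIS' FACTORISATION THEOREM, CONVERSE HALF, FOR A COMPLETE INEQUALITY FAMILY.**  Let `P = conv(v_b : b ∈ B)` and
let `(c_a · x ≤ d_a)_{a ∈ A}` be a family of inequalities — indexed by an ARBITRARY (possibly infinite) type — that is
COMPLETE for `P` (every point satisfying all of them lies in `P`).  If the slack matrix `d_a − c_a·v_b` has a nonnegative
factorisation through a finite slot type `σ`, then `P` has an extended formulation of size `|σ|`: the slack-form system
`{x | ∃ y ≥ 0, ∀ a, c_a·x + U_a·y = d_a}` (finitely many of its equations suffice — a finite spanning set of the triples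
`(c_a, U_a, d_a)`), whose projection is exactly `P` (`⊇`: lift `v_b` with `y = W_b`; `⊆`: `y ≥ 0` gives `c_a·x ≤ d_a` for
every `a`, then completeness).  Validity of the rows on `P` is automatic (the slacks are nonnegative).
[cite: Yannakakis1991, Theorem 3 (xc(P) = rank₊ of the slack matrix; the direction "factorisation ⇒ EF")]
[cite: FioriniEtAl2015, Theorem 3 (§2, the factorisation theorem restated)] -/
theorem hasEFOfSize_of_complete_nonneg_factorization (v : B → ι → ℝ) (c : A → ι → ℝ) (d : A → ℝ)
    (hcomplete : ∀ x : ι → ℝ, (∀ a, c a ⬝ᵥ x ≤ d a) → x ∈ convexHull ℝ (Set.range v))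
    (U : A → σ → ℝ) (W : B → σ → ℝ) (hU : ∀ a i, 0 ≤ U a i) (hW : ∀ b i, 0 ≤ W b i)
    (hfac : ∀ a b, d a - c a ⬝ᵥ v b = ∑ i, U a i * W b i) :
    HasEFOfSize (convexHull ℝ (Set.range v)) (Fintype.card σ) := by
  classical
  -- the triples and a finite spanning subset of them
  let θf : A → Trip ι σ := fun a => (c a, (U a, d a))
  obtain ⟨t, ht⟩ : (Submodule.span ℝ (Set.range θf)).FG := IsNoetherian.noetherian _
  -- the factorisation identities, as equations of the triples, on all of the span
  have hgen : ∀ b : B, ∀ θ ∈ Submodule.span ℝ (Set.range θf), θ.1 ⬝ᵥ v b + θ.2.1 ⬝ᵥ W b = θ.2.2 := by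
    intro b
    refine eq_of_mem_span (v b) (W b) (Set.range θf) ?_
    rintro _ ⟨a, rfl⟩
    have h := hfac a b
    show c a ⬝ᵥ v b + U a ⬝ᵥ W b = d a
    have hUW : U a ⬝ᵥ W b = ∑ i, U a i * W b i := rfl
    linarith
  -- the finite system
  let E : Matrix t ι ℝ := fun θ p => θ.1.1 p
  let Fm : Matrix t σ ℝ := fun θ i => θ.1.2.1 i
  let g : t → ℝ := fun θ => θ.1.2.2
  have hsys : ∀ (x : ι → ℝ) (y : σ → ℝ),
      E *ᵥ x + Fm *ᵥ y = g ↔ ∀ θ : t, θ.1.1 ⬝ᵥ x + θ.1.2.1 ⬝ᵥ y = θ.1.2.2 := by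
    intro x y
    constructor
    · intro h θ
      have := congrFun h θ
      simpa [E, Fm, g, mulVec] using this
    · intro h
      funext θ
      simpa [E, Fm, g, mulVec] using h θ
  have hEF := hasEFOfSize_of_system (ι := ι) E Fm g
  -- the system's projection is exactly `P`
  have key : {x : ι → ℝ | ∃ y : σ → ℝ, (∀ j, 0 ≤ y j) ∧ E *ᵥ x + Fm *ᵥ y = g} = convexHull ℝ (Set.range v) := by
    refine Set.Subset.antisymm ?_ ?_
    · -- `⊆ P`: every row inequality holds, then completeness
      rintro x ⟨y, hy, hxy⟩
      rw [hsys] at hxy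
      refine hcomplete x fun a => ?_
      have hθ : θf a ∈ Submodule.span ℝ (Set.range θf) := Submodule.subset_span ⟨a, rfl⟩
      rw [← ht] at hθ
      have heq : (θf a).1 ⬝ᵥ x + (θf a).2.1 ⬝ᵥ y = (θf a).2.2 :=
        eq_of_mem_span x y (↑t : Set (Trip ι σ)) (fun θ hθt => hxy ⟨θ, hθt⟩) (θf a) hθ
      have hUy : 0 ≤ U a ⬝ᵥ y := Finset.sum_nonneg fun i _ => mul_nonneg (hU a i) (hy i)
      change c a ⬝ᵥ x + U a ⬝ᵥ y = d a at heq
      linarith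
    · -- `P ⊆`: the projection is convex and contains every `v_b`
      have hconv : Convex ℝ {x : ι → ℝ | ∃ y : σ → ℝ, (∀ j, 0 ≤ y j) ∧ E *ᵥ x + Fm *ᵥ y = g} := by
        intro x₁ hx₁ x₂ hx₂ a' b' ha hb hab
        obtain ⟨y₁, hy₁, h₁⟩ := hx₁
        obtain ⟨y₂, hy₂, h₂⟩ := hx₂
        refine ⟨a' • y₁ + b' • y₂, fun j => ?_, ?_⟩
        · simp only [Pi.add_apply, Pi.smul_apply, smul_eq_mul]
          exact add_nonneg (mul_nonneg ha (hy₁ j)) (mul_nonneg hb (hy₂ j))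
        · rw [Matrix.mulVec_add, Matrix.mulVec_add, Matrix.mulVec_smul, Matrix.mulVec_smul, Matrix.mulVec_smul,
            Matrix.mulVec_smul]
          have : a' • (E *ᵥ x₁) + b' • (E *ᵥ x₂) + (a' • (Fm *ᵥ y₁) + b' • (Fm *ᵥ y₂))
              = a' • (E *ᵥ x₁ + Fm *ᵥ y₁) + b' • (E *ᵥ x₂ + Fm *ᵥ y₂) := by
            simp only [smul_add]; abel
          rw [this, h₁, h₂, ← add_smul, hab, one_smul]
      have hgens : Set.range v ⊆ {x : ι → ℝ | ∃ y : σ → ℝ, (∀ j, 0 ≤ y j) ∧ E *ᵥ x + Fm *ᵥ y = g} := by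
        rintro _ ⟨b, rfl⟩
        refine ⟨W b, fun i => hW b i, ?_⟩
        rw [hsys]
        intro θ
        have hθ : (θ.1 : Trip ι σ) ∈ Submodule.span ℝ (Set.range θf) := by
          rw [← ht]
          exact Submodule.subset_span θ.2
        exact hgen b θ.1 hθ
      exact convexHull_min hgens hconv
  rw [key] at hEF
  exact hEF

end Yannakakis

/-! ## §2b Sharp row families and the EF built from a blind factorisation of `COR(n) + Q` -/

/-- ★ A row family is SHARP if, at every order, for every direction `w` and every `δ > 0` it contains a positive multiple
`t • w` of `w` with right-hand side `δ`-close to exact: `β ≤ t (h_COR(w) + δ)`.  (Any family closed under scaling the tilt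
of an exact-rhs pencil is sharp: the clique offset is scaled away.)  Sharp families are COMPLETE for every `COR(n) + Q`
(`complete_of_sharp`). -/
def Sharp (F : RowFamily) : Prop :=
  ∀ (n : ℕ) (w : Fin (n * n) → ℝ) (δ : ℝ), 0 < δ →
    ∃ a : F.A n, ∃ t : ℝ, 0 < t ∧ F.ρ n a = t • w ∧ F.β n a ≤ t * (hCORv w + δ)

section EF
variable (F : RowFamily) {n K : ℕ} {σ : Type} [Fintype σ]

/-- the vertex list of `COR(n) + Q`: `(a, j) ↦ 𝟙_a𝟙_aᵀ + q_j` over bit strings `a`. -/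
def sumVert (n : ℕ) {K : ℕ} (q : Fin (K + 1) → (Fin (n * n) → ℝ)) : Cube n × Fin (K + 1) → (Fin (n * n) → ℝ) :=
  fun p => vecOuter n (bvec p.1) + q p.2

/-- `COR(n) + conv(q) = conv(sumVert)`. -/
theorem cor_add_convexHull_eq (q : Fin (K + 1) → (Fin (n * n) → ℝ)) :
    corPolytope n + convexHull ℝ (Set.range q) = convexHull ℝ (Set.range (sumVert n q)) := by
  have hr : Set.range (sumVert n q) = Set.range (fun a : Cube n => vecOuter n (bvec a)) + Set.range q := by
    ext x
    simp only [Set.mem_range, Set.mem_add, sumVert]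
    constructor
    · rintro ⟨⟨a, j⟩, rfl⟩
      exact ⟨_, ⟨a, rfl⟩, _, ⟨j, rfl⟩, rfl⟩
    · rintro ⟨_, ⟨a, rfl⟩, _, ⟨j, rfl⟩, rfl⟩
      exact ⟨⟨a, j⟩, rfl⟩
  rw [hr, convexHull_add]
  rfl

/-- ★ sharp families are COMPLETE: a point satisfying `ρ_a·x ≤ β_a + m_a` for every row (with `m_a` attained passenger
maxima) lies in `COR(n) + Q`. -/
theorem complete_of_sharp (hF : Sharp F) (q : Fin (K + 1) → (Fin (n * n) → ℝ))
    (m : F.A n → ℝ) (hmax : ∀ a, ∃ j, F.ρ n a ⬝ᵥ q j = m a) (x : Fin (n * n) → ℝ)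
    (hrow : ∀ a : F.A n, F.ρ n a ⬝ᵥ x ≤ F.β n a + m a) :
    x ∈ corPolytope n + convexHull ℝ (Set.range q) := by
  refine mem_add_convexHull_of_forall_le q x fun w => ?_
  refine le_of_forall_pos_le_add fun δ hδ => ?_
  obtain ⟨a, t', ht', hρ, hβ⟩ := hF n w δ hδ
  obtain ⟨j, hj⟩ := hmax a
  have h1 := hrow a
  rw [hρ, smul_dotProduct, smul_eq_mul] at h1
  rw [hρ, smul_dotProduct, smul_eq_mul] at hj
  have h2 : w ⬝ᵥ q j ≤ hQv q w := le_hQv q w j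
  have h3 : t' * (w ⬝ᵥ q j) ≤ t' * hQv q w := mul_le_mul_of_nonneg_left h2 ht'.le
  have h4 : t' * (w ⬝ᵥ x) ≤ t' * (hCORv w + hQv q w + δ) := by nlinarith
  exact le_of_mul_le_mul_left h4 ht'

/-- ★ **THE EF FROM A BLIND FACTORISATION OF A SHARP FAMILY'S SLACK.**  If the `F`-slack of `COR(n) + Q`
(`Q = conv(q)`, attained passenger maxima `m`) factors nonnegatively through slots `σ`, then `xc(COR(n) + Q) ≤ |σ|`. -/
theorem hasEFOfSize_of_sharp_factorization (hF : Sharp F) (q : Fin (K + 1) → (Fin (n * n) → ℝ))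
    (m : F.A n → ℝ) (hmax : ∀ a, ∃ j, F.ρ n a ⬝ᵥ q j = m a)
    (U : F.A n → σ → ℝ) (V : Finset (Fin n) × Fin (K + 1) → σ → ℝ)
    (hU : ∀ a i, 0 ≤ U a i) (hV : ∀ p i, 0 ≤ V p i)
    (hfac : ∀ a b j, (F.β n a + m a) - F.ρ n a ⬝ᵥ (udPt b + q j) = ∑ i, U a i * V (b, j) i) :
    HasEFOfSize (corPolytope n + convexHull ℝ (Set.range q)) (Fintype.card σ) := by
  classical
  rw [cor_add_convexHull_eq]
  refine hasEFOfSize_of_complete_nonneg_factorization (sumVert n q) (F.ρ n) (fun a => F.β n a + m a) ?_ U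
    (fun p => V (Finset.univ.filter (fun i => p.1 i = true), p.2)) hU (fun p i => hV _ i) ?_
  · intro x hrow
    rw [← cor_add_convexHull_eq]
    exact complete_of_sharp F hF q m hmax x hrow
  · rintro a ⟨b, j⟩
    have h := hfac a (Finset.univ.filter (fun i => b i = true)) j
    simp only [sumVert]
    rw [vecOuter_bvec_eq_udPt]
    exact h

end EF

/-! ## §3 The law of a sharp family is COR-VIRTUAL -/

/-- `T c n < T (c+1) n` once `n ≥ 2`. -/
theorem T_lt_T_succ {c n : ℕ} (hn : 2 ≤ n) : T c n < T (c + 1) n := by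
  unfold T
  have hL : 1 ≤ Nat.log 2 n := Nat.log_pos (by norm_num) hn
  set L := Nat.log 2 n with hLdef
  refine Nat.pow_lt_pow_right (by norm_num) ?_
  have h1 : (L + c) ^ c ≤ (L + c + 1) ^ c := Nat.pow_le_pow_left (by omega) c
  have h2 : 1 ≤ (L + c) ^ c := Nat.one_le_pow c (L + c) (by omega)
  have h3 : L + (c + 1) = L + c + 1 := by omega
  rw [h3, pow_succ]
  calc (L + c) ^ c < (L + c) ^ c * 2 := by omega
    _ ≤ (L + c + 1) ^ c * (L + c + 1) := Nat.mul_le_mul h1 (by omega)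

/-- ★★ **THE LAW OF A SHARP ROW FAMILY FOLLOWS FROM COR-VIRTUAL.** -/
theorem law_of_corVirtualHardN (F : RowFamily) (hF : Sharp F) (hV : CorVirtualHardN) : F.Law := by
  classical
  intro c
  obtain ⟨n₀, hn₀⟩ := hV (c + 1)
  refine ⟨max n₀ 2, fun n hn K q r hQ m hmq hmax U V hU hV' hfac => ?_⟩
  have hn₀' : n₀ ≤ n := le_trans (le_max_left _ _) hn
  have hn2 : 2 ≤ n := le_trans (le_max_right _ _) hn
  have hEF : HasEFOfSize (corPolytope n + convexHull ℝ (Set.range q)) (r + 1) := by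
    have h := hasEFOfSize_of_sharp_factorization F hF q m hmax U V hU hV' hfac
    simpa [Fintype.card_option] using h
  have h1 : T (c + 1) n < r + 1 := hn₀ n hn₀' K q (r + 1) hEF hQ.succ
  have h2 : T c n < T (c + 1) n := T_lt_T_succ hn2
  omega

/-! ## §4 The three families of record are sharp; the four laws are one statement -/

/-- `exactTilted` is sharp: the pencil `(∅, unflat (w/δ))` (`udRow ∅ = 0`, `β = 1 + h_COR(w)/δ`). -/
theorem exactTilted_sharp : Sharp exactTilted := by
  intro n w δ hδ
  refine ⟨((∅ : Finset (Fin n)), unflat ((1 / δ) • w)), 1 / δ, by positivity, ?_, ?_⟩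
  · show udRow (∅ : Finset (Fin n)) + flat (unflat ((1 / δ) • w)) = (1 / δ) • w
    rw [udRow_empty, flat_unflat, zero_add]
  · show 1 + hCOR (unflat ((1 / δ) • w)) ≤ 1 / δ * (hCORv w + δ)
    have h := hCORv_smul_le (t := 1 / δ) (by positivity) w
    rw [hCORv_eq_hCOR_unflat] at h
    have hδ' : 1 / δ * δ = 1 := by field_simp
    nlinarith

/-- `pinnedRows` is sharp: the pencil `(∅, (w/δ, argmax_b ⟨w, x_b⟩))`. -/
theorem pinnedRows_sharp : Sharp pinnedRows := by
  intro n w δ hδ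
  obtain ⟨S, hS⟩ := exists_eq_hCORv w
  have hpin : ∀ x ∈ corPolytope n, ((1 / δ) • w) ⬝ᵥ x ≤ ((1 / δ) • w) ⬝ᵥ udPt S := by
    intro x hx
    rw [smul_dotProduct, smul_dotProduct, smul_eq_mul, smul_eq_mul, hS]
    exact mul_le_mul_of_nonneg_left (le_hCORv_of_mem w x hx) (by positivity)
  refine ⟨((∅ : Finset (Fin n)), ⟨((1 / δ) • w, S), hpin⟩), 1 / δ, by positivity, ?_, ?_⟩
  · show udRow (∅ : Finset (Fin n)) + (1 / δ) • w = (1 / δ) • w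
    rw [udRow_empty, zero_add]
  · show 1 + ((1 / δ) • w) ⬝ᵥ udPt S ≤ 1 / δ * (hCORv w + δ)
    rw [smul_dotProduct, smul_eq_mul, hS]
    have hδ' : 1 / δ * δ = 1 := by field_simp
    nlinarith

/-- `allRows` is sharp: it contains the exact row `(w, h_COR(w))` itself. -/
theorem allRows_sharp : Sharp allRows := by
  intro n w δ hδ
  refine ⟨⟨(w, hCORv w), le_hCORv_of_mem w⟩, 1, one_pos, ?_, ?_⟩
  · show w = (1 : ℝ) • w
    rw [one_smul]
  · show hCORv w ≤ 1 * (hCORv w + δ)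
    linarith

/-- ★★★ **`ExactPencilLaw ↔ CorVirtualHardN`** — the law of record C′ is COR-VIRTUAL itself. -/
theorem exactPencilLaw_iff_corVirtualHardN : ExactPencilLaw ↔ CorVirtualHardN :=
  ⟨corVirtualHardN_of_exactPencilLaw, fun h => law_of_corVirtualHardN exactTilted exactTilted_sharp h⟩

/-- ★★★ `pinnedRows.Law ↔ CorVirtualHardN` — the "strongest" located law is COR-VIRTUAL too. -/
theorem pinnedRowsLaw_iff_corVirtualHardN : pinnedRows.Law ↔ CorVirtualHardN :=
  ⟨corVirtualHardN_of_pinnedRowsLaw, fun h => law_of_corVirtualHardN pinnedRows pinnedRows_sharp h⟩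

/-- ★★★ `allRows.Law ↔ CorVirtualHardN` (Yannakakis both ways). -/
theorem allRowsLaw_iff_corVirtualHardN : allRows.Law ↔ CorVirtualHardN :=
  ⟨corVirtualHardN_of_law allRows, fun h => law_of_corVirtualHardN allRows allRows_sharp h⟩

/-- ★★★ the chain `exact_law_chain` is a cycle: all four laws are equivalent. -/
theorem located_laws_equivalent :
    (pinnedRows.Law ↔ ExactPencilLaw) ∧ (ExactPencilLaw ↔ allRows.Law) ∧ (allRows.Law ↔ CorVirtualHardN) :=
  ⟨pinnedRowsLaw_iff_corVirtualHardN.trans exactPencilLaw_iff_corVirtualHardN.symm,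
    exactPencilLaw_iff_corVirtualHardN.trans allRowsLaw_iff_corVirtualHardN.symm, allRowsLaw_iff_corVirtualHardN⟩

/-- POINTWISE (species) form, for the record: at ANY order and passenger, an `exactTilted`-blind factorisation through
`r + 1` slots yields `xc(COR(n) + Q) ≤ r + 1` — «C′ decides species X» and «COR-VIRTUAL holds on X» are the same claim
up to the `+1` in the slot count. -/
theorem hasEFOfSize_of_exactTilted_blind {n K r : ℕ} (q : Fin (K + 1) → (Fin (n * n) → ℝ))
    (m : exactTilted.A n → ℝ) (hmax : ∀ a, ∃ j, exactTilted.ρ n a ⬝ᵥ q j = m a)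
    (U : exactTilted.A n → Option (Fin r) → ℝ) (V : Finset (Fin n) × Fin (K + 1) → Option (Fin r) → ℝ)
    (hU : ∀ a i, 0 ≤ U a i) (hV : ∀ p i, 0 ≤ V p i)
    (hfac : ∀ a b j, (exactTilted.β n a + m a) - exactTilted.ρ n a ⬝ᵥ (udPt b + q j) = ∑ i, U a i * V (b, j) i) :
    HasEFOfSize (corPolytope n + convexHull ℝ (Set.range q)) (r + 1) := by
  have h := hasEFOfSize_of_sharp_factorization exactTilted exactTilted_sharp q m hmax U V hU hV hfac
  simpa [Fintype.card_option] using h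



/-! ## §5 The graph currency: `CorVirtualHardN ↔ CorVirtualHardG` (so, with the line's rev-21 `coreLawOrb_iff_corVirtualHard`,
`ExactPencilLaw ↔ stub_coreLaw` up to δ-equal restatement) -/

/-- COR-VIRTUAL in the GRAPH currency `corPolytopeGraph ⊤ ⊂ ℝ^{Fin h × Fin h}` — VERBATIM the line's `VPLine.CorVirtualHard`
(`Lines/virtual_passenger.lean` l.111, with the δ-equal `LocatedRows.T`), restated so that this workfile need not import the line. -/
def CorVirtualHardG : Prop :=
  ∀ c : ℕ, ∃ h₀ : ℕ, ∀ h ≥ h₀, ∀ (K : ℕ) (q : Fin (K + 1) → (Fin h × Fin h → ℝ)) (r : ℕ),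
    HasEFOfSize (convexHull ℝ (Set.range q)) r →
    HasEFOfSize (corPolytopeGraph (⊤ : SimpleGraph (Fin h)) + convexHull ℝ (Set.range q)) r → T c h < r

/-- flat ⇒ graph (verbatim the line's `corVirtualHard_of_corVirtualHardN`, val-idea-39 g3 P-P1a). -/
theorem corVirtualHardG_of_corVirtualHardN (hN : CorVirtualHardN) : CorVirtualHardG := by
  intro c
  obtain ⟨h₀, hh₀⟩ := hN c
  refine ⟨h₀, fun h hh K q r hQ hR => ?_⟩
  let e : (Fin h × Fin h → ℝ) ≃ₗ[ℝ] (Fin (h * h) → ℝ) :=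
    LinearEquiv.funCongrLeft ℝ ℝ (finProdFinEquiv (m := h) (n := h)).symm
  have hQimg : e '' convexHull ℝ (Set.range q) = convexHull ℝ (Set.range (e ∘ q)) := by
    rw [Set.range_comp]; exact e.toLinearMap.image_convexHull (Set.range q)
  have himg : e '' (corPolytopeGraph (⊤ : SimpleGraph (Fin h)) + convexHull ℝ (Set.range q)) =
      corPolytope h + convexHull ℝ (Set.range (e ∘ q)) := by
    rw [Set.image_add, Literature.Barriers.PneNP.corPolytope_eq_image_corPolytopeGraph_top, hQimg]
  have hR' : HasEFOfSize (corPolytope h + convexHull ℝ (Set.range (e ∘ q))) r := by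
    rw [← himg]; exact (Literature.Barriers.PneNP.HasEFOfSize.image_linearEquiv_iff e).2 hR
  have hQ' : HasEFOfSize (convexHull ℝ (Set.range (e ∘ q))) r := by
    rw [← hQimg]; exact (Literature.Barriers.PneNP.HasEFOfSize.image_linearEquiv_iff e).2 hQ
  exact hh₀ h hh K (e ∘ q) r hR' hQ'

/-- ★ graph ⇒ flat (the direction the tree lacked): pull the flat passenger back along the same linear equivalence. -/
theorem corVirtualHardN_of_corVirtualHardG (hG : CorVirtualHardG) : CorVirtualHardN := by
  intro c
  obtain ⟨h₀, hh₀⟩ := hG c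
  refine ⟨h₀, fun n hn K q' r hR' hQ' => ?_⟩
  let e : (Fin n × Fin n → ℝ) ≃ₗ[ℝ] (Fin (n * n) → ℝ) :=
    LinearEquiv.funCongrLeft ℝ ℝ (finProdFinEquiv (m := n) (n := n)).symm
  let q : Fin (K + 1) → (Fin n × Fin n → ℝ) := fun j => e.symm (q' j)
  have heq : e ∘ q = q' := funext fun j => e.apply_symm_apply (q' j)
  have hQimg : e '' convexHull ℝ (Set.range q) = convexHull ℝ (Set.range q') := by
    rw [← heq, Set.range_comp]; exact e.toLinearMap.image_convexHull (Set.range q)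
  have himg : e '' (corPolytopeGraph (⊤ : SimpleGraph (Fin n)) + convexHull ℝ (Set.range q)) =
      corPolytope n + convexHull ℝ (Set.range q') := by
    rw [Set.image_add, Literature.Barriers.PneNP.corPolytope_eq_image_corPolytopeGraph_top, hQimg]
  have hR : HasEFOfSize (corPolytopeGraph (⊤ : SimpleGraph (Fin n)) + convexHull ℝ (Set.range q)) r := by
    rw [← Literature.Barriers.PneNP.HasEFOfSize.image_linearEquiv_iff e, himg]; exact hR'
  have hQ : HasEFOfSize (convexHull ℝ (Set.range q)) r := by
    rw [← Literature.Barriers.PneNP.HasEFOfSize.image_linearEquiv_iff e, hQimg]; exact hQ'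
  exact hh₀ n hn K q r hQ hR

/-- ★★ the two currencies agree. -/
theorem corVirtualHardN_iff_corVirtualHardG : CorVirtualHardN ↔ CorVirtualHardG :=
  ⟨corVirtualHardG_of_corVirtualHardN, corVirtualHardN_of_corVirtualHardG⟩

/-- ★★★ C′ in the line's own currency: `ExactPencilLaw ↔ CorVirtualHardG` (compose with the pen's rev-21
`coreLawOrb_iff_corVirtualHard : CoreLawOrb ↔ CorVirtualHard`, δ-equal to `CorVirtualHardG`: C′ ⟺ the registered research stub). -/
theorem exactPencilLaw_iff_corVirtualHardG : ExactPencilLaw ↔ CorVirtualHardG :=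
  exactPencilLaw_iff_corVirtualHardN.trans corVirtualHardN_iff_corVirtualHardG



end Summit.ValiantsHypothesis.ValiantsHypothesis.Cruxes.NNDivisionHard.ValIdea41.ExactIsVirtual

end
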